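import Summits.SmoothPoincare4.SmoothPoincare4.Theorems.DottedCircleRasmussenDcrGapHelperFriendsCarrierTkAux10

/-!
# Helper `helper_friendsCarrier_Tk_endSmoothFormulas` of stub `helper_friendsCarrier_Tk` — the end collar, part 4: overlaps and smooth formulas
(item stmt-SmoothPoincare4-16128, route route-SmoothPoincare4-DottedCircleRasmussen)

Continuation of `…TkAux8–10` (end collar, parts 1–3), porting the sections *Agreement of the local
formulas on overlaps* and *Smoothness of the three collar formulas in coordinates* of the tree's
`OpenTraceCollar.lean`:

* `cRad_eq_cTube`, `cTube_eq_cFlat`, `ΨRad_eq_ΨTube`, `ΨTube_eq_ΨFlat` — the radial/tube/flat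
  formulas (and their inverses) agree on the overlaps of their regimes (closed forms of the profile `Φ`);
* `fRad`, `fTube` — the radial and tube formulas in coordinates, `cRad = incl ∘ fRad`,
  `cTube = incl ∘ fTube ∘ (ι₀ × id)`, `cFlat = inr ∘ fF`; `contDiff_fRad`, `contMDiffOn_fTube` (and the
  template's `contMDiff_fF`) — their smoothness;
* `helper_friendsCarrier_Tk_endSmoothFormulas` — the registered summary (explicit forms).

Everything is proved; no named facts, no `sorry`.
References: Kirby (1989), Ch. I §5 [Kirby1989]; the tree's `OpenTraceCollar.lean`, `TraceCollarProfile.lean`.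
-/

-- the prescribed namespace `Summit.<P>.<Sub>.…` duplicates `SmoothPoincare4` (P = Sub)
set_option linter.dupNamespace false
set_option linter.style.longLine false

noncomputable section

open scoped Manifold ContDiff Topology
open Function Set Metric
open Literature.Topology.FourManifolds Literature.Topology.FourManifolds.MMSW

namespace Summit.SmoothPoincare4.SmoothPoincare4.Theorems.DcrGap.MkFriends

namespace FriendsTk

namespace EndDatum

variable {k : ℕ} (E : EndDatum k)

/-! ### Agreement of the local formulas on overlaps -/

/-- **R = P on the overlap**: for `a = ν₀(u, w)` with `‖w‖ ≥ 2` the radial and tube formulas agree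
(the profile is in its radial regime: `Φ⁻¹(D, ‖w‖) = (D, log(2/‖w‖))`). [folklore] -/
theorem cRad_eq_cTube (u : Metric.sphere (0 : EuclideanSpace ℝ (Fin 2)) 1) {w : EuclideanSpace ℝ (Fin 2)} (hw : 2 ≤ ‖w‖) (σ : ℝ) :
    E.cRad (E.ν₀ (u, w)) σ = E.cTube (E.ν₀ (u, w)) σ := by
  have hwpos : 0 < ‖w‖ := by linarith
  have hD : 0 < Real.exp (-σ) := Real.exp_pos _
  rw [cTube_apply, baseP_apply, TraceCollar.Φinv_of_two_le hD hw, ptT, cRad]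
  simp only
  rw [neg_neg, Real.exp_log (by positivity), mul_div_cancel₀ _ (two_ne_zero' ℝ), norm_smul_coe_radialProjection]

/-- **P = F on the overlap**: for `p ≠ 0` in the flat regime `‖p‖ e^{ψinv D} ≤ 1` the tube formula at
`ν₀(p̂, ‖p‖ v)` is the flat formula at `(p, v)`. [folklore] -/
theorem cTube_eq_cFlat {pv : EuclideanSpace ℝ (Fin 2)} (hp : pv ≠ 0) (v : Metric.sphere (0 : EuclideanSpace ℝ (Fin 2)) 1) (σ : ℝ)
    (hflat : ‖pv‖ * Real.exp (TraceCollar.ψinv (Real.exp (-σ))) ≤ 1) :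
    E.cTube (E.ν₀ (radialProjection (spherePt 1) pv, ‖pv‖ • (v : EuclideanSpace ℝ (Fin 2)))) σ = E.cFlat (pv, v) σ := by
  have hppos : 0 < ‖pv‖ := norm_pos_iff.2 hp
  have hD : 0 < Real.exp (-σ) := Real.exp_pos _
  have hYd : 0 < TraceCollar.ψinv (Real.exp (-σ)) := TraceCollar.ψinv_pos _
  have hk : 0 < TubeNbhd.kOf σ := by rw [TubeNbhd.kOf]; positivity
  have hfp : TraceCollar.Φinv (Real.exp (-σ), ‖‖pv‖ • (v : EuclideanSpace ℝ (Fin 2))‖) =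
      TraceCollar.flatPoint (Real.exp (-σ), ‖pv‖) := by
    rw [norm_smul_coe_sphere hppos.le]
    exact TraceCollar.Φinv_eq_flatPoint hD hppos hflat
  have hX : (TraceCollar.flatPoint (Real.exp (-σ), ‖pv‖)).1 = ‖pv‖ * TubeNbhd.kOf σ := by
    simp only [TraceCollar.flatPoint, TubeNbhd.kOf]; ring
  have hXpos : 0 < ‖pv‖ * TubeNbhd.kOf σ := mul_pos hppos hk
  have hr : 0 < 2 * Real.exp (-TraceCollar.ψinv (Real.exp (-σ))) := by positivity
  have hr2 : 2 * Real.exp (-TraceCollar.ψinv (Real.exp (-σ))) < 2 := by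
    have : Real.exp (-TraceCollar.ψinv (Real.exp (-σ))) < 1 := Real.exp_lt_one_iff.2 (by linarith)
    linarith
  rw [cTube_apply, baseP_apply, hfp, hX, show (TraceCollar.flatPoint (Real.exp (-σ), ‖pv‖)).2 =
      TraceCollar.ψinv (Real.exp (-σ)) from rfl, radialProjection_smul _ hppos,
    E.ptT_eq_inr (TraceCollar.αof_pos hXpos) hr hr2, cFlat, TubeNbhd.fF]
  congr 2
  rw [TraceCollar.αof_eq_Gs_mul, coe_radialProjection_of_ne_zero _ hp, smul_smul]
  congr 1
  field_simp

/-- **R' = P' on the overlap**: for a band point `y` with handle radius `α ∈ (0, 1)` whose drop is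
`ν₀(u, w)` with `‖w‖ ≥ 2`, the radial and tube inverse formulas agree. [folklore] -/
theorem ΨRad_eq_ΨTube {Y : Type*} (jM : EuclideanSpace ℝ (Fin 4) → Y) {y : EuclideanSpace ℝ (Fin 4)} (hα : 0 < E.radA y)
    (hα1 : E.radA y < 1) {u : Metric.sphere (0 : EuclideanSpace ℝ (Fin 2)) 1} {w : EuclideanSpace ℝ (Fin 2)} (hw : 2 ≤ ‖w‖)
    (hyu : E.dropA y = E.ν₀ (u, w)) : E.ΨRad jM y = E.ΨTube jM y := by
  have hwpos : 0 < ‖w‖ := by linarith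
  have hX : 0 < TraceCollar.ξ (E.radA y) := TraceCollar.ξ_pos hα hα1
  have hY : Real.log (2 / ‖w‖) ≤ 0 := Real.log_nonpos (by positivity) ((div_le_one hwpos).2 hw)
  have hΦ : E.profP y = (TraceCollar.ξ (E.radA y), 2 * Real.exp (-Real.log (2 / ‖w‖))) := by
    rw [profP, hyu, E.ι₀_ν₀]
    exact TraceCollar.Φ_of_nonpos (p := (TraceCollar.ξ (E.radA y), Real.log (2 / ‖w‖))) hX hY
  rw [ΨTube, ΨRad, hΦ, hyu, E.ι₀_ν₀]
  simp only [TubeNbhd.two_mul_exp_neg_log hwpos]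
  refine Prod.ext ?_ rfl
  show jM (E.ν₀ (u, w)) = E.ptY jM ‖w‖ u (radialProjection (spherePt 1) w)
  rw [ptY, norm_smul_coe_radialProjection]

namespace Presentation

variable {E} {Y : Type*} [TopologicalSpace Y] [ChartedSpace (EuclideanSpace ℝ (Fin 3)) Y] (P : E.Presentation Y)

/-- **The solid-torus form of `ptY`**: for `0 < τ < 1`, `jM (ν₀(u, τ v)) = jB (τ u, v)`. [folklore] -/
theorem ptY_eq_jBt {τ : ℝ} (hτ : 0 < τ) (hτ1 : τ < 1) (u v : Metric.sphere (0 : EuclideanSpace ℝ (Fin 2)) 1) :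
    E.ptY P.jM τ u v = TubeNbhd.jBt P.jB (τ • (u : EuclideanSpace ℝ (Fin 2)), v) := by
  rw [ptY, TubeNbhd.jBt_of_norm_lt P.jB (by simpa [norm_smul_coe_sphere hτ.le] using hτ1)]
  exact (P.rel _ (E.ν₀_mem _) (E.ν₀_smul_not_mem_range hτ.ne' _ _) _).2 ⟨u, τ, ⟨hτ, hτ1⟩, rfl, rfl⟩

/-- **P' = F' on the overlap**: for a handle-chart point `(x, w'')` with `x ≠ 0`, `‖x‖ < 1` in the flat
regime, the tube inverse formula at `bwd (x, w'')` is the flat inverse formula. [folklore] -/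
theorem ΨTube_eq_ΨFlat {x : EuclideanSpace ℝ (Fin 2)} (hx : x ≠ 0) (hx1 : ‖x‖ < 1) {w : EuclideanSpace ℝ (Fin 2)} (hw : w ≠ 0)
    (hflat : 2 * TraceCollar.ξ ‖x‖ ≤
      TraceCollar.ψ (Real.log (2 / ‖OpenPartialHomeomorph.univBall (0 : EuclideanSpace ℝ (Fin 2)) 2 w‖))) :
    E.ΨTube P.jM (E.bwd (x, w)) = TubeNbhd.ΨFlat P.jB (x, w) := by
  set w' := OpenPartialHomeomorph.univBall (0 : EuclideanSpace ℝ (Fin 2)) 2 w with hw'def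
  have hw' : w' ≠ 0 := TubeNbhd.univBall_ne_zero hw
  have hw'pos : 0 < ‖w'‖ := norm_pos_iff.2 hw'
  have hw'2 : ‖w'‖ < 2 := TubeNbhd.norm_univBall_lt w
  have hxpos : 0 < ‖x‖ := norm_pos_iff.2 hx
  have hYy : 0 < Real.log (2 / ‖w'‖) := Real.log_pos ((lt_div_iff₀ hw'pos).2 (by linarith))
  have hξ : 0 ≤ TraceCollar.ξ ‖x‖ := TraceCollar.ξ_nonneg hxpos.le hx1
  -- the band point, its handle radius and its drop
  have hy : E.bwd (x, w) = E.θ (E.collarTime ‖x‖, E.ν₀ (radialProjection (spherePt 1) x, w')) := by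
    conv_lhs => rw [← norm_smul_coe_radialProjection (spherePt 1) x]
    rw [E.bwd_smul hxpos, E.νK_eq]
  obtain ⟨hdrop, hrad, -⟩ := E.dropA_radA_ptA_arg (E.ν₀_mem (radialProjection (spherePt 1) x, w')) hxpos
  -- the profile is in its flat regime
  have hΦ : E.profP (E.bwd (x, w)) =
      (TraceCollar.ψ (Real.log (2 / ‖w'‖)),
        2 * Real.exp (-Real.log (2 / ‖w'‖)) * (TraceCollar.ξ ‖x‖ / TraceCollar.ψ (Real.log (2 / ‖w'‖)))) := by
    rw [profP, hy, hrad, hdrop, E.ι₀_ν₀]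
    exact TraceCollar.Φ_of_flat (p := (TraceCollar.ξ ‖x‖, Real.log (2 / ‖w'‖))) hξ hYy hflat
  have hψ : 0 < TraceCollar.ψ (Real.log (2 / ‖w'‖)) := TraceCollar.ψ_pos hYy
  set τ : ℝ := 2 * Real.exp (-Real.log (2 / ‖w'‖)) * (TraceCollar.ξ ‖x‖ / TraceCollar.ψ (Real.log (2 / ‖w'‖)))
    with hτdef
  have hτeq : τ = ‖w'‖ * (TraceCollar.ξ ‖x‖ / TraceCollar.ψ (Real.log (2 / ‖w'‖))) := by
    rw [hτdef, TubeNbhd.two_mul_exp_neg_log hw'pos]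
  have hτpos : 0 < τ := by
    rw [hτeq]; exact mul_pos hw'pos (div_pos (TraceCollar.ξ_pos hxpos hx1) hψ)
  have hτ1 : τ < 1 := by
    rw [hτeq]
    have h1 : TraceCollar.ξ ‖x‖ / TraceCollar.ψ (Real.log (2 / ‖w'‖)) ≤ 2⁻¹ := by
      rw [div_le_iff₀ hψ]; linarith
    calc ‖w'‖ * (TraceCollar.ξ ‖x‖ / TraceCollar.ψ (Real.log (2 / ‖w'‖))) ≤ ‖w'‖ * 2⁻¹ := by gcongr
      _ < 1 := by linarith
  rw [ΨTube, hΦ, hy, hdrop, E.ι₀_ν₀, TubeNbhd.ΨFlat]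
  simp only
  rw [P.ptY_eq_jBt hτpos hτ1, show TubeNbhd.radF (x, w) = ‖w'‖ from rfl]
  congr 2
  refine Prod.ext ?_ rfl
  show τ • ((radialProjection (spherePt 1) x : Metric.sphere (0 : EuclideanSpace ℝ (Fin 2)) 1) : EuclideanSpace ℝ (Fin 2)) =
    (‖w'‖ / TraceCollar.ψ (Real.log (2 / ‖w'‖)) * (1 - ‖x‖ ^ 2)⁻¹) • x
  rw [hτeq, coe_radialProjection_of_ne_zero _ hx, smul_smul, TraceCollar.ξ_eq_mul]
  congr 1
  field_simp

end Presentation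

/-! ### The collar formulas in coordinates and their smoothness -/

/-- The radial formula in coordinates: `(a, σ) ↦ θ(s(αof e^{-σ}), a)`. [folklore] -/
def fRad (q : EuclideanSpace ℝ (Fin 4) × ℝ) : EuclideanSpace ℝ (Fin 4) :=
  E.θ (E.collarTime (TraceCollar.αof (Real.exp (-q.2))), q.1)

/-- The tube formula in coordinates: `((u, w), σ) ↦ θ(s(αof X), ν₀(u, 2e^{-Y} ŵ))`,
`(X, Y) = Φ⁻¹(e^{-σ}, ‖w‖)`. [folklore] -/
def fTube (q : ((Metric.sphere (0 : EuclideanSpace ℝ (Fin 2)) 1) × EuclideanSpace ℝ (Fin 2)) × ℝ) : EuclideanSpace ℝ (Fin 4) :=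
  E.θ (E.collarTime (TraceCollar.αof (TraceCollar.Φinv (Real.exp (-q.2), ‖q.1.2‖)).1),
    E.ν₀ (q.1.1, (2 * Real.exp (-(TraceCollar.Φinv (Real.exp (-q.2), ‖q.1.2‖)).2)) •
      ((radialProjection (spherePt 1) q.1.2 : Metric.sphere (0 : EuclideanSpace ℝ (Fin 2)) 1) : EuclideanSpace ℝ (Fin 2))))

/-- The radial formula is `incl ∘ fRad` (definitionally). [folklore] -/
theorem cRad_eq_fRad (a : EuclideanSpace ℝ (Fin 4)) (σ : ℝ) : E.cRad a σ = E.incl (E.fRad (a, σ)) := rfl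

/-- The tube formula is `incl ∘ fTube` in tube coordinates (definitionally). [folklore] -/
theorem cTube_eq_fTube (a : EuclideanSpace ℝ (Fin 4)) (σ : ℝ) : E.cTube a σ = E.incl (E.fTube (E.ι₀ a, σ)) := rfl

/-- The flat formula is `inr ∘ fF` (definitionally). [folklore] -/
theorem cFlat_eq_fF (b : EuclideanSpace ℝ (Fin 2) × Metric.sphere (0 : EuclideanSpace ℝ (Fin 2)) 1) (σ : ℝ) :
    E.cFlat b σ = E.trGlueData.inr (TubeNbhd.fF (b, σ)) := rfl

/-- The time function `X ↦ s(αof X) = δ(1 - αof X)/(1 + αof X)` is smooth where `X > 0`. [folklore] -/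
theorem contDiffAt_collarTime_αof' {δ : ℝ} {X : ℝ} (hX : 0 < X) :
    ContDiffAt ℝ ∞ (fun X : ℝ => δ * (1 - TraceCollar.αof X) / (1 + TraceCollar.αof X)) X := by
  have hα := TraceCollar.αof_pos hX
  have hden : 1 + TraceCollar.αof X ≠ 0 := by linarith
  exact (contDiffAt_const.mul (contDiffAt_const.sub TraceCollar.contDiff_αof.contDiffAt)).div
    (contDiffAt_const.add TraceCollar.contDiff_αof.contDiffAt) hden

/-- **The radial formula is smooth** (explicit form). [folklore] -/
theorem contDiff_radialFormula {θ : ℝ × EuclideanSpace ℝ (Fin 4) → EuclideanSpace ℝ (Fin 4)} {δ : ℝ} (hθ : ContDiff ℝ ∞ θ) :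
    ContDiff ℝ ∞ (fun q : EuclideanSpace ℝ (Fin 4) × ℝ =>
      θ (δ * (1 - TraceCollar.αof (Real.exp (-q.2))) / (1 + TraceCollar.αof (Real.exp (-q.2))), q.1)) := by
  rw [contDiff_iff_contDiffAt]
  intro q
  have h1 : ContDiffAt ℝ ∞ (fun q : EuclideanSpace ℝ (Fin 4) × ℝ =>
      δ * (1 - TraceCollar.αof (Real.exp (-q.2))) / (1 + TraceCollar.αof (Real.exp (-q.2)))) q := by
    have he : ContDiffAt ℝ ∞ (fun q : EuclideanSpace ℝ (Fin 4) × ℝ => Real.exp (-q.2)) q :=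
      (Real.contDiff_exp.comp contDiff_snd.neg).contDiffAt
    exact (contDiffAt_collarTime_αof' (δ := δ) (Real.exp_pos _)).comp q he
  exact hθ.contDiffAt.comp q (h1.prodMk contDiffAt_fst)

/-- **The tube formula is smooth** in tube coordinates off the knot (`w ≠ 0`; explicit form). [folklore] -/
theorem contMDiffOn_tubeFormula {ν₀ : (Metric.sphere (0 : EuclideanSpace ℝ (Fin 2)) 1) × EuclideanSpace ℝ (Fin 2) → EuclideanSpace ℝ (Fin 4)}
    {θ : ℝ × EuclideanSpace ℝ (Fin 4) → EuclideanSpace ℝ (Fin 4)} {δ : ℝ} (hθ : ContDiff ℝ ∞ θ)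
    (hν₀ : ContMDiff ((𝓡 1).prod 𝓘(ℝ, EuclideanSpace ℝ (Fin 2))) 𝓘(ℝ, EuclideanSpace ℝ (Fin 4)) ∞ ν₀) :
    ContMDiffOn (((𝓡 1).prod 𝓘(ℝ, EuclideanSpace ℝ (Fin 2))).prod 𝓘(ℝ, ℝ)) 𝓘(ℝ, EuclideanSpace ℝ (Fin 4)) ∞
      (fun q : ((Metric.sphere (0 : EuclideanSpace ℝ (Fin 2)) 1) × EuclideanSpace ℝ (Fin 2)) × ℝ =>
        θ (δ * (1 - TraceCollar.αof (TraceCollar.Φinv (Real.exp (-q.2), ‖q.1.2‖)).1) /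
            (1 + TraceCollar.αof (TraceCollar.Φinv (Real.exp (-q.2), ‖q.1.2‖)).1),
          ν₀ (q.1.1, (2 * Real.exp (-(TraceCollar.Φinv (Real.exp (-q.2), ‖q.1.2‖)).2)) •
            ((radialProjection (spherePt 1) q.1.2 : Metric.sphere (0 : EuclideanSpace ℝ (Fin 2)) 1) : EuclideanSpace ℝ (Fin 2)))))
      {q | q.1.2 ≠ 0} := by
  haveI : Fact (Module.finrank ℝ (EuclideanSpace ℝ (Fin 2)) = 1 + 1) := ⟨by simp⟩
  intro q hq
  have hq' : q.1.2 ≠ 0 := hq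
  have hbase := TubeNbhd.contMDiffAt_baseMap hq'
  have hX : 0 < (TraceCollar.Φinv (Real.exp (-q.2), ‖q.1.2‖)).1 :=
    TraceCollar.Φinv_mem (TubeNbhd.mem_Quad_of_ne_zero q.2 hq')
  -- the time `s(αof X)`
  have h1 : ContMDiffAt (((𝓡 1).prod 𝓘(ℝ, EuclideanSpace ℝ (Fin 2))).prod 𝓘(ℝ, ℝ)) 𝓘(ℝ, ℝ) ∞
      (fun q : ((Metric.sphere (0 : EuclideanSpace ℝ (Fin 2)) 1) × EuclideanSpace ℝ (Fin 2)) × ℝ =>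
        δ * (1 - TraceCollar.αof (TraceCollar.Φinv (Real.exp (-q.2), ‖q.1.2‖)).1) /
          (1 + TraceCollar.αof (TraceCollar.Φinv (Real.exp (-q.2), ‖q.1.2‖)).1)) q := by
    have ha : ContDiffAt ℝ ∞ (fun r : ℝ × ℝ => δ * (1 - TraceCollar.αof r.1) / (1 + TraceCollar.αof r.1))
        (TraceCollar.Φinv (Real.exp (-q.2), ‖q.1.2‖)) :=
      (contDiffAt_collarTime_αof' (δ := δ) hX).comp _ contDiffAt_fst
    exact ContMDiffAt.comp (g := fun r : ℝ × ℝ => δ * (1 - TraceCollar.αof r.1) / (1 + TraceCollar.αof r.1))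
      (f := fun q : ((Metric.sphere (0 : EuclideanSpace ℝ (Fin 2)) 1) × EuclideanSpace ℝ (Fin 2)) × ℝ =>
        TraceCollar.Φinv (Real.exp (-q.2), ‖q.1.2‖)) q ha.contMDiffAt hbase
  -- the radius `2 e^{-Y}`
  have h2 : ContMDiffAt (((𝓡 1).prod 𝓘(ℝ, EuclideanSpace ℝ (Fin 2))).prod 𝓘(ℝ, ℝ)) 𝓘(ℝ, ℝ) ∞
      (fun q : ((Metric.sphere (0 : EuclideanSpace ℝ (Fin 2)) 1) × EuclideanSpace ℝ (Fin 2)) × ℝ =>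
        2 * Real.exp (-(TraceCollar.Φinv (Real.exp (-q.2), ‖q.1.2‖)).2)) q := by
    have ha : ContDiff ℝ ∞ (fun r : ℝ × ℝ => 2 * Real.exp (-r.2)) :=
      contDiff_const.mul (Real.contDiff_exp.comp contDiff_snd.neg)
    exact ha.contDiffAt.contMDiffAt.comp q hbase
  -- the direction `ŵ` as a vector
  have h3 : ContMDiffAt (((𝓡 1).prod 𝓘(ℝ, EuclideanSpace ℝ (Fin 2))).prod 𝓘(ℝ, ℝ)) 𝓘(ℝ, EuclideanSpace ℝ (Fin 2)) ∞
      (fun q : ((Metric.sphere (0 : EuclideanSpace ℝ (Fin 2)) 1) × EuclideanSpace ℝ (Fin 2)) × ℝ =>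
        ((radialProjection (spherePt 1) q.1.2 : Metric.sphere (0 : EuclideanSpace ℝ (Fin 2)) 1) : EuclideanSpace ℝ (Fin 2))) q := by
    have hr : ContMDiffAt 𝓘(ℝ, EuclideanSpace ℝ (Fin 2)) (𝓡 1) ∞ (radialProjection (spherePt 1)) q.1.2 :=
      (contMDiffOn_radialProjection (spherePt 1)).contMDiffAt (isOpen_ne.mem_nhds hq')
    exact (contMDiff_coe_sphere (E := EuclideanSpace ℝ (Fin 2)) (n := 1)).contMDiffAt.comp q
      (hr.comp q (contMDiff_snd.comp contMDiff_fst).contMDiffAt)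
  -- the fibre vector
  have h4 : ContMDiffAt (((𝓡 1).prod 𝓘(ℝ, EuclideanSpace ℝ (Fin 2))).prod 𝓘(ℝ, ℝ)) 𝓘(ℝ, EuclideanSpace ℝ (Fin 2)) ∞
      (fun q : ((Metric.sphere (0 : EuclideanSpace ℝ (Fin 2)) 1) × EuclideanSpace ℝ (Fin 2)) × ℝ =>
        (2 * Real.exp (-(TraceCollar.Φinv (Real.exp (-q.2), ‖q.1.2‖)).2)) •
          ((radialProjection (spherePt 1) q.1.2 : Metric.sphere (0 : EuclideanSpace ℝ (Fin 2)) 1) : EuclideanSpace ℝ (Fin 2))) q :=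
    (TubeNbhd.contDiff_smul_pair (EuclideanSpace ℝ (Fin 2))).contMDiff.contMDiffAt.comp q (h2.prodMk_space h3)
  -- the tube point
  have h5 : ContMDiffAt (((𝓡 1).prod 𝓘(ℝ, EuclideanSpace ℝ (Fin 2))).prod 𝓘(ℝ, ℝ)) 𝓘(ℝ, EuclideanSpace ℝ (Fin 4)) ∞
      (fun q : ((Metric.sphere (0 : EuclideanSpace ℝ (Fin 2)) 1) × EuclideanSpace ℝ (Fin 2)) × ℝ => ν₀ (q.1.1,
        (2 * Real.exp (-(TraceCollar.Φinv (Real.exp (-q.2), ‖q.1.2‖)).2)) •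
          ((radialProjection (spherePt 1) q.1.2 : Metric.sphere (0 : EuclideanSpace ℝ (Fin 2)) 1) : EuclideanSpace ℝ (Fin 2)))) q := by
    have hu : ContMDiffAt (((𝓡 1).prod 𝓘(ℝ, EuclideanSpace ℝ (Fin 2))).prod 𝓘(ℝ, ℝ)) (𝓡 1) ∞
        (fun q : ((Metric.sphere (0 : EuclideanSpace ℝ (Fin 2)) 1) × EuclideanSpace ℝ (Fin 2)) × ℝ => q.1.1) q :=
      (contMDiff_fst.comp contMDiff_fst).contMDiffAt
    exact hν₀.contMDiffAt.comp q (hu.prodMk h4)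
  exact (hθ.contMDiff.contMDiffAt.comp q (h1.prodMk_space h5)).contMDiffWithinAt

/-- The radial formula is smooth. [folklore] -/
theorem contDiff_fRad : ContDiff ℝ ∞ E.fRad := contDiff_radialFormula (δ := E.δ) E.contDiff_θ

/-- The tube formula is smooth in tube coordinates off the knot. [folklore] -/
theorem contMDiffOn_fTube : ContMDiffOn (((𝓡 1).prod 𝓘(ℝ, EuclideanSpace ℝ (Fin 2))).prod 𝓘(ℝ, ℝ)) 𝓘(ℝ, EuclideanSpace ℝ (Fin 4)) ∞ E.fTube
    {q | q.1.2 ≠ 0} :=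
  contMDiffOn_tubeFormula (δ := E.δ) E.contDiff_θ E.contMDiff_ν₀

end EndDatum

end FriendsTk

/-- **Helper `helper_friendsCarrier_Tk_endSmoothFormulas`** (registered on the crux item; end collar part 4
of stub `helper_friendsCarrier_Tk`): the radial collar formula `(a, σ) ↦ θ(s(αof e^{-σ}), a)` is `C^∞`
on `ℝ⁴ × ℝ`, and the tube formula `((u, w), σ) ↦ θ(s(αof X), ν₀(u, 2e^{-Y} ŵ))`,
`(X, Y) = Φ⁻¹(e^{-σ}, ‖w‖)` (the corner-turning profile of `TraceCollarProfile.lean`), is `C^∞` in tube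
coordinates off the knot — the coordinate expressions whose smoothness makes the end collar of the trace
smooth (Kirby 1989, Ch. I §5). [cite: Kirby1989, Ch. I §5] -/
theorem helper_friendsCarrier_Tk_endSmoothFormulas : ∀ (ν₀ : (sphere (0 : EuclideanSpace ℝ (Fin 2)) 1) × EuclideanSpace ℝ (Fin 2) → EuclideanSpace ℝ (Fin 4)) (θ : ℝ × EuclideanSpace ℝ (Fin 4) → EuclideanSpace ℝ (Fin 4)) (δ : ℝ), 0 < δ → ContDiff ℝ ((⊤ : ℕ∞) : WithTop ℕ∞) θ → ContMDiff ((𝓡 1).prod 𝓘(ℝ, EuclideanSpace ℝ (Fin 2))) 𝓘(ℝ, EuclideanSpace ℝ (Fin 4)) ((⊤ : ℕ∞) : WithTop ℕ∞) ν₀ → ContDiff ℝ ((⊤ : ℕ∞) : WithTop ℕ∞) (fun q : EuclideanSpace ℝ (Fin 4) × ℝ => θ (δ * (1 - TraceCollar.αof (Real.exp (-q.2))) / (1 + TraceCollar.αof (Real.exp (-q.2))), q.1)) ∧ ContMDiffOn (((𝓡 1).prod 𝓘(ℝ, EuclideanSpace ℝ (Fin 2))).prod 𝓘(ℝ, ℝ))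 𝓘(ℝ, EuclideanSpace ℝ (Fin 4)) ((⊤ : ℕ∞) : WithTop ℕ∞) (fun q : ((sphere (0 : EuclideanSpace ℝ (Fin 2)) 1) × EuclideanSpace ℝ (Fin 2)) × ℝ => θ (δ * (1 - TraceCollar.αof (TraceCollar.Φinv (Real.exp (-q.2), ‖q.1.2‖)).1) / (1 + TraceCollar.αof (TraceCollar.Φinv (Real.exp (-q.2), ‖q.1.2‖)).1), ν₀ (q.1.1, (2 * Real.exp (-(TraceCollar.Φinv (Real.exp (-q.2), ‖q.1.2‖)).2)) • ((radialProjection (spherePt 1) q.1.2 : (sphere (0 : EuclideanSpace ℝ (Fin 2)) 1)) : EuclideanSpace ℝ (Fin 2))))) {q | q.1.2 ≠ 0} :=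
  fun _ _ _ _ hθ hν₀ => ⟨FriendsTk.EndDatum.contDiff_radialFormula hθ, FriendsTk.EndDatum.contMDiffOn_tubeFormula hθ hν₀⟩

end Summit.SmoothPoincare4.SmoothPoincare4.Theorems.DcrGap.MkFriends

end
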